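import Summits.Ventures.AbcSig.Rows.Bridge
import Summits.Ventures.AbcSig.Rows.XTemplateC2c

/-!
# Venture AbcSig — bridge from REDUCED C2c rows to p1's census predicate `Rows.C2cCell` (exponent reduction `m ↦ m mod n`)

HONEST FRAMING. COMPUTATION cell `pub-abcsig`; bookkeeping only; no claim on ABC or any summit. p1's predicate
`Rows.C2cCell ℓ R` (`Rows/Statements.lean`) quantifies over ALL `m ≥ 1` with `n ∤ m` (and all coprime distributions
`A·B = ℓ^m`), whereas the rows produced from `Rows/XTemplateC2c.lean` assume the REDUCED exponent `1 ≤ m < n` (RULING H1;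
needed for `B` to be `n`-th-power free in [BS04, Lemma 3.3]). This file proves the routine reduction: writing
`m = q·n + r` with `0 < r < n`, a primitive solution `(x, y, z)` of `xⁿ + ℓ^m yⁿ = 2z²` gives the primitive solution
`(x, ℓ^q·y, z)` of `xⁿ + ℓ^r yⁿ = 2z²` (same equation; coprimality is inherited), and `x·(ℓ^q y) = ±1` would force `q = 0`.
THEOREM `C2cCell_of_rows`: reduced first-distribution rows for every `1 ≤ m < n` ⇒ `Rows.C2cCell ℓ R` (the second
distribution by `IsPrimitiveSolution.swap`, the coprime distributions by `coprime_distributions` with `a = 0`).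
-/

namespace Summit.Ventures.AbcSig

/-- Exponent reduction for `(1, ℓ^(q n + r), 2)`: `(x, y, z) ↦ (x, ℓ^q y, z)` is a primitive solution for `(1, ℓ^r, 2)`. -/
theorem IsPrimitiveSolution.reduceC2c {ℓ q r n : ℕ} {x y z : ℤ} (hℓ : ℓ.Prime) (hr : 0 < r)
    (h : IsPrimitiveSolution 1 (ℓ ^ (q * n + r)) 2 n x y z) :
    IsPrimitiveSolution 1 (ℓ ^ r) 2 n x ((ℓ : ℤ) ^ q * y) z := by
  obtain ⟨heq, hx0, hy0, hz0, hxy, hxz, hyz⟩ := h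
  have hℓ0 : (ℓ : ℤ) ≠ 0 := by exact_mod_cast hℓ.ne_zero
  have hpow : ((ℓ ^ (q * n + r) : ℕ) : ℤ) * y ^ n = ((ℓ ^ r : ℕ) : ℤ) * ((ℓ : ℤ) ^ q * y) ^ n := by
    push_cast
    rw [mul_pow, ← pow_mul, pow_add]
    ring
  have hpos : 0 < q * n + r := by omega
  push_cast at hxy hyz hy0 ⊢
  have hxl : IsCoprime ((1 : ℤ) * x) ((ℓ : ℤ) ^ (q * n + r)) := hxy.of_mul_right_left
  have hxy' : IsCoprime ((1 : ℤ) * x) y := hxy.of_mul_right_right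
  have hxℓ : IsCoprime ((1 : ℤ) * x) (ℓ : ℤ) := (IsCoprime.pow_right_iff hpos).mp hxl
  have hly : IsCoprime ((ℓ : ℤ) ^ (q * n + r)) (2 * z) := hyz.of_mul_left_left
  have hyz' : IsCoprime y (2 * z) := hyz.of_mul_left_right
  have hℓz : IsCoprime (ℓ : ℤ) (2 * z) := (IsCoprime.pow_left_iff hpos).mp hly
  refine ⟨?_, hx0, ?_, hz0, ?_, hxz, ?_⟩
  · push_cast at heq ⊢
    have : (ℓ : ℤ) ^ r * ((ℓ : ℤ) ^ q * y) ^ n = (ℓ : ℤ) ^ (q * n + r) * y ^ n := by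
      rw [mul_pow, ← pow_mul, pow_add]; ring
    rw [this]; exact heq
  · have hy : y ≠ 0 := by
      intro hy; apply hy0; simp [hy]
    exact mul_ne_zero (pow_ne_zero _ hℓ0) (mul_ne_zero (pow_ne_zero _ hℓ0) hy)
  · exact hxℓ.pow_right.mul_right (hxℓ.pow_right.mul_right hxy')
  · exact hℓz.pow_left.mul_left (hℓz.pow_left.mul_left hyz')

/-- **Bridge.** Reduced first-distribution C2c rows (`1 ≤ m < n`, `B = 2⁰·ℓ^m`) for every admissible exponent give p1's
unreduced census predicate `Rows.C2cCell ℓ R` (all `m ≥ 1` with `n ∤ m`, all coprime distributions `A·B = ℓ^m`). -/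
theorem C2cCell_of_rows (ℓ : ℕ) (hℓ : ℓ.Prime) (hℓ2 : ℓ ≠ 2) (R : Finset ℕ)
    (h : ∀ n : ℕ, n.Prime → 11 ≤ n → n ≠ ℓ → n ∉ R → ∀ m : ℕ, 1 ≤ m → m < n →
      ∀ x y z : ℤ, x * y ≠ 1 → x * y ≠ -1 → ¬ IsPrimitiveSolution 1 (2 ^ 0 * ℓ ^ m) 2 n x y z) :
    Rows.C2cCell ℓ R := by
  intro n hn h11 hnℓ hR A B m hm hnm hAB hprod x y z h1 h2 hsol
  -- reduce the exponent: m = q n + r, 0 < r < n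
  set q := m / n with hq
  set r := m % n with hr
  have hmqr : m = q * n + r := by rw [hq, hr, mul_comm]; exact (Nat.div_add_mod m n).symm
  have hr0 : 0 < r := Nat.pos_of_ne_zero (fun h0 => hnm (Nat.dvd_of_mod_eq_zero h0))
  have hrn : r < n := Nat.mod_lt m (by omega)
  -- the two coprime distributions of ℓ^m
  have hprod' : A * B = 2 ^ 0 * ℓ ^ m := by simpa using hprod
  have hred : ∀ x y z : ℤ, x * y ≠ 1 → x * y ≠ -1 → ¬ IsPrimitiveSolution 1 (ℓ ^ m) 2 n x y z := by
    intro x y z h1 h2 hs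
    rw [hmqr] at hs
    have hs' := IsPrimitiveSolution.reduceC2c (q := q) hℓ hr0 hs
    have hℓ1 : 1 < (ℓ : ℤ) := by exact_mod_cast hℓ.one_lt
    refine h n hn h11 hnℓ hR r (by omega) hrn x ((ℓ : ℤ) ^ q * y) z ?_ ?_ (by simpa using hs')
    · intro h1'
      have habs : |x * ((ℓ : ℤ) ^ q * y)| = 1 := by rw [h1']; simp
      rcases Nat.eq_zero_or_pos q with hq0 | hqpos
      · rw [hq0, pow_zero, one_mul] at h1'; exact h1 h1'
      · have hx : x ≠ 0 := by rintro rfl; simp at h1'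
        have hy : y ≠ 0 := by rintro rfl; simp at h1'
        have : (ℓ : ℤ) ≤ |x * ((ℓ : ℤ) ^ q * y)| := by
          rw [abs_mul, abs_mul, abs_pow, abs_of_nonneg (by positivity : (0 : ℤ) ≤ ℓ)]
          calc (ℓ : ℤ) = 1 * ((ℓ : ℤ) ^ 1 * 1) := by ring
            _ ≤ |x| * ((ℓ : ℤ) ^ q * |y|) := by
              gcongr
              · exact Int.one_le_abs hx
              · omega
              · exact hqpos
              · exact Int.one_le_abs hy
        omega
    · intro h2'
      rcases Nat.eq_zero_or_pos q with hq0 | hqpos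
      · rw [hq0, pow_zero, one_mul] at h2'; exact h2 h2'
      · have hx : x ≠ 0 := by rintro rfl; simp at h2'
        have hy : y ≠ 0 := by rintro rfl; simp at h2'
        have : (ℓ : ℤ) ≤ |x * ((ℓ : ℤ) ^ q * y)| := by
          rw [abs_mul, abs_mul, abs_pow, abs_of_nonneg (by positivity : (0 : ℤ) ≤ ℓ)]
          calc (ℓ : ℤ) = 1 * ((ℓ : ℤ) ^ 1 * 1) := by ring
            _ ≤ |x| * ((ℓ : ℤ) ^ q * |y|) := by
              gcongr
              · exact Int.one_le_abs hx
              · omega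
              · exact hqpos
              · exact Int.one_le_abs hy
        have hℓ1 : 1 < (ℓ : ℤ) := by exact_mod_cast hℓ.one_lt
        rw [h2'] at this; simp at this; omega
  rcases coprime_distributions hℓ hℓ2 hAB hprod' with ⟨rfl, rfl⟩ | ⟨rfl, rfl⟩ | ⟨rfl, rfl⟩ | ⟨rfl, rfl⟩
  · exact hred x y z h1 h2 (by simpa using hsol)
  · exact hred y x z (by rwa [mul_comm]) (by rwa [mul_comm]) (by simpa using hsol.swap)
  · exact hred x y z h1 h2 (by simpa using hsol)
  · exact hred y x z (by rwa [mul_comm]) (by rwa [mul_comm]) (by simpa using hsol.swap)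

end Summit.Ventures.AbcSig
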